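import Summits.PneNP.PneNP.Theorems.SingleThreshold.Negative.Density
import Literature.Computability.Complexity.RossmanMonotoneCliqueApprox
import Literature.Computability.Complexity.RossmanMonotoneCliqueGraphs
import Literature.Computability.Complexity.CliqueThresholdBounds
import Literature.Computability.Complexity.GnpSprinkling

/-!
# `SingleThreshold` (stmt-PneNP-2833) — negative-side lemmas VI: planting a small pattern keeps the
critical `G(n,p)` clique-free; every `f ≤ CLIQUE_k` is ⋆-closed at the self-noise parameters

Support for the `-- Targets` analysis of the registered skeleton
`Cruxes/SingleThreshold/Lines/self-noise-closure.lean` (stub `stub_positiveTrigger`); used by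
`Negative/PositiveTrigger.lean`.

* `le_gnpProb_cliqueFree_sup`, `sum_pow_outEdges_le`, `eventually_le_gnpProb_cliqueFree_sup` —
  **planting any pattern `h` with fewer than `k` non-isolated vertices leaves `G(n,p_c)` free of
  `k`-cliques with probability `≥ cfree k = e^{-2(1+k2^k)}`**, eventually in `n`, uniformly in `h`
  (Harris' inequality over the decreasing events `K_B ⊈ G ∪ h`, each of probability
  `1 - p^{#outEdges B h}`, and the overlap sum of Rossman 2010, App. B at `b = 1`).
* `gnpProb_forall_off`, `gnpProb_off_outside`, `kSubsetProb_mono_card`, `sum_gnpWeight_mul_kSubsetProb` —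
  bookkeeping (`Pr[no edge of F] = (1-p)^{#F}`, swapping the `G(n,p)`- and the `k`-set averages).
* `isClosedFn_of_le_cliqueFn` — consequently **every function `f ≤ CLIQUE_k` (monotone or not) is
  ⋆-closed (`IsClosedFn`, Rossman's Def. 8) for the critical bias `p_c`, any trigger `t < cfree k` and
  any class of patterns of support `< k`** — in particular for `(p_c, n^{-a}, smallI ∪ medJ)`, the
  parameters of line `self-noise-closure`: for such `f` the closure condition `Pr[f(G ∪ h) = 0] ≤ t`
  never fires. So ⋆-closedness of the OUTPUT wire carries no information beyond `f̄ ≤ CLIQUE_k`-type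
  facts; cf. `positiveTrigger_false_without_program` in `Negative/PositiveTrigger.lean`.

Refuter seat cdisprove-stmt-PneNP-2833 (gen 2), 2026-08-16.
-/

namespace Summit.PneNP.PneNP.Theorems.SingleThreshold.Negative

open Literature.Computability.Complexity Finset Filter Classical

noncomputable section

variable {n : ℕ}

/-! ### Planting a small pattern keeps clique-freeness likely -/

/-- The edges of `K_B` that are NOT switched on by the pattern `h`. [folklore] -/
def outEdges (B : Finset (Fin n)) (h : Edges n → Bool) : Finset (Edges n) :=
  univ.filter fun e => cliqueVec B e = true ∧ h e = false

/-- `Pr[K_B ⊆ G ∪ h] = p^{#outEdges B h}` (only the edges of `K_B` outside `h` have to be present).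
[folklore] -/
theorem gnpProb_forall_cliqueVec_sup_pattern (p : ℝ) (B : Finset (Fin n)) (h : Edges n → Bool) :
    gnpProb n p (univ.filter fun x : Edges n → Bool =>
        ∀ e, cliqueVec B e = true → (x ⊔ h) e = true) = p ^ #(outEdges B h) := by
  rw [← sum_gnpWeight_filter_forall, gnpProb]
  refine sum_congr (filter_congr fun x _ => ?_) fun _ _ => rfl
  simp only [outEdges, mem_filter, mem_univ, true_and, sup_apply_bool, Bool.or_eq_true]
  constructor
  · rintro hx e ⟨hB, hh⟩
    rcases hx e hB with h1 | h1
    · exact h1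
    · rw [hh] at h1
      exact absurd h1 Bool.false_ne_true
  · intro hx e hB
    by_cases hh : h e = true
    · exact Or.inr hh
    · exact Or.inl (hx e ⟨hB, Bool.eq_false_iff.2 hh⟩)

/-- If the support of `h` lies inside the `k`-set `A`, the edges of `K_B` outside `K_A` are outside
`h`: `C(|B|,2) - C(|A ∩ B|,2) ≤ #outEdges B h`. [folklore] -/
theorem choose_sub_le_card_outEdges (A B : Finset (Fin n)) (h : Edges n → Bool)
    (hA : supp h ⊆ A) : (#B).choose 2 - (#(A ∩ B)).choose 2 ≤ #(outEdges B h) := by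
  rw [← card_filter_cliqueVec_and_not A B]
  refine card_le_card fun e he => ?_
  simp only [mem_filter, mem_univ, true_and, outEdges] at he ⊢
  refine ⟨he.1, ?_⟩
  by_contra hhe
  rw [Bool.not_eq_false] at hhe
  have : cliqueVec A e = true :=
    (cliqueVec_eq_true_iff_endpts A e).2 ((endpts_subset_supp hhe).trans hA)
  rw [he.2] at this
  exact Bool.false_ne_true this

/-- A `k`-set `B` (`k ≥ 2`) has an edge outside any pattern with fewer than `k` non-isolated
vertices. [folklore] -/
theorem one_le_card_outEdges {k : ℕ} (hk : 2 ≤ k) {B : Finset (Fin n)} (hB : #B = k)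
    {h : Edges n → Bool} (hh : #(supp h) < k) : 1 ≤ #(outEdges B h) := by
  -- a vertex of `B` outside the support of `h`, and a second vertex of `B`
  obtain ⟨u, huB, hu⟩ : ∃ u ∈ B, u ∉ supp h := by
    by_contra hno
    push Not at hno
    have := card_le_card (show B ⊆ supp h from hno)
    omega
  have hcard : 1 < #B := by omega
  obtain ⟨v, hvB, hvu⟩ := exists_mem_ne hcard u
  rw [Nat.one_le_iff_ne_zero, Ne, card_eq_zero, ← Ne, ← nonempty_iff_ne_empty]
  refine ⟨⟨s(u, v), by simpa using hvu.symm⟩, mem_filter.2 ⟨mem_univ _, ?_, ?_⟩⟩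
  · simp only [cliqueVec, decide_eq_true_eq]
    intro w hw
    rcases Sym2.mem_iff.1 hw with rfl | rfl
    · exact huB
    · exact hvB
  · by_contra hon
    rw [Bool.not_eq_false] at hon
    exact hu (endpts_subset_supp hon ((mem_endpts _ u).2 (Sym2.mem_mk_left u v)))

/-- **Planted Harris bound.** For `0 ≤ p ≤ 1/2`, `k ≥ 2` and a pattern `h` with fewer than `k`
non-isolated vertices: `Pr[ω_k(G ∪ h) = 0] ≥ exp(-2 Σ_B p^{#outEdges B h})`, the product over the
decreasing events `K_B ⊈ G ∪ h` (Harris) evaluated termwise (`1 - q ≥ e^{-2q}` for `q ≤ 1/2`).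
[cite: Rossman2010, App. B (proof of Lemma 23 (a), p. 14)] -/
theorem le_gnpProb_cliqueFree_sup {p : ℝ} (hp0 : 0 ≤ p) (hp : p ≤ 1 / 2) {k : ℕ} (hk : 2 ≤ k)
    {h : Edges n → Bool} (hh : #(supp h) < k) :
    Real.exp (-(2 * ∑ B ∈ powersetCard k (univ : Finset (Fin n)), p ^ #(outEdges B h))) ≤
      gnpProb n p (univ.filter fun x : Edges n → Bool => cliqueFn n k (x ⊔ h) = false) := by
  have hp1 : p ≤ 1 := hp.trans (by norm_num)
  set 𝒜 := powersetCard k (univ : Finset (Fin n)) with h𝒜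
  -- Harris
  have hD : ∀ B ∈ 𝒜, ∀ x y : Edges n → Bool, x ≤ y →
      ¬ (∀ e, cliqueVec B e = true → (y ⊔ h) e = true) →
        ¬ (∀ e, cliqueVec B e = true → (x ⊔ h) e = true) :=
    fun B _ x y hxy hy hx => hy (forall_cliqueVec_of_le B (sup_le_sup_right hxy _) hx)
  have step3 : ∏ B ∈ 𝒜, gnpProb n p (univ.filter fun x : Edges n → Bool =>
        ¬ ∀ e, cliqueVec B e = true → (x ⊔ h) e = true) ≤
      gnpProb n p (univ.filter fun x : Edges n → Bool =>
        ∀ B ∈ 𝒜, ¬ ∀ e, cliqueVec B e = true → (x ⊔ h) e = true) := by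
    convert prod_gnpProb_le_gnpProb_forall hp0 hp1 𝒜
      (fun B x => ¬ ∀ e, cliqueVec B e = true → (x ⊔ h) e = true) hD using 3
  -- each factor
  have step4 : ∀ B ∈ 𝒜, gnpProb n p (univ.filter fun x : Edges n → Bool =>
      ¬ ∀ e, cliqueVec B e = true → (x ⊔ h) e = true) = 1 - p ^ #(outEdges B h) := by
    intro B _
    have hset : (univ.filter fun x : Edges n → Bool =>
        ¬ ∀ e, cliqueVec B e = true → (x ⊔ h) e = true) =
        (univ.filter fun x : Edges n → Bool => ∀ e, cliqueVec B e = true → (x ⊔ h) e = true)ᶜ := by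
      ext x; simp
    rw [hset, gnpProb_compl, gnpProb_forall_cliqueVec_sup_pattern]
  have step5 : Real.exp (-(2 * ∑ B ∈ 𝒜, p ^ #(outEdges B h))) ≤
      ∏ B ∈ 𝒜, (1 - p ^ #(outEdges B h)) := by
    refine exp_neg_two_mul_sum_le_prod_one_sub _ _ (fun B _ => pow_nonneg hp0 _) fun B hB => ?_
    have hBk : #B = k := (mem_powersetCard.1 hB).2
    calc p ^ #(outEdges B h) ≤ p ^ 1 := pow_le_pow_of_le_one hp0 hp1 (one_le_card_outEdges hk hBk hh)
      _ ≤ 1 / 2 := by rwa [pow_one]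
  -- the target event
  have step6 : gnpProb n p (univ.filter fun x : Edges n → Bool =>
        ∀ B ∈ 𝒜, ¬ ∀ e, cliqueVec B e = true → (x ⊔ h) e = true) =
      gnpProb n p (univ.filter fun x : Edges n → Bool => cliqueFn n k (x ⊔ h) = false) := by
    congr 1
    refine filter_congr fun x _ => ?_
    rw [← cliqueCount_eq_zero_iff_forall, cliqueCount_eq_zero_iff]
  calc Real.exp (-(2 * ∑ B ∈ 𝒜, p ^ #(outEdges B h)))
      ≤ ∏ B ∈ 𝒜, (1 - p ^ #(outEdges B h)) := step5
    _ = ∏ B ∈ 𝒜, gnpProb n p (univ.filter fun x : Edges n → Bool =>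
          ¬ ∀ e, cliqueVec B e = true → (x ⊔ h) e = true) :=
        prod_congr rfl fun B hB => (step4 B hB).symm
    _ ≤ _ := step3
    _ = _ := step6

/-- **The overlap sum for a small pattern at the threshold**: for `n ≥ k ≥ 2`,
`0 ≤ p ≤ n^{-2/(k-1)}` and `#supp h < k`, `Σ_B p^{#outEdges B h} ≤ 1 + k 2^k` (choose a `k`-set
`A ⊇ supp h`; the term `B = A` is `≤ 1`, the others are `≤ p^{C(k,2) - C(|A∩B|,2)}`, summed by
`sum_erase_pow_inter_le`). [cite: Rossman2010, App. B (proof of Lemma 23 (a), p. 14)] -/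
theorem sum_pow_outEdges_le {k : ℕ} (hk : 2 ≤ k) (hkn : k ≤ n) {p : ℝ} (hp0 : 0 ≤ p) (hp1 : p ≤ 1)
    (hpb : p ≤ 1 * (n : ℝ) ^ (-(2 : ℝ) / ((k : ℝ) - 1))) {h : Edges n → Bool} (hh : #(supp h) < k) :
    ∑ B ∈ powersetCard k (univ : Finset (Fin n)), p ^ #(outEdges B h) ≤ 1 + k * 2 ^ k := by
  have hn : 1 ≤ n := by omega
  -- a `k`-set containing the support of `h`
  obtain ⟨A, hhA, -, hAk⟩ : ∃ A : Finset (Fin n), supp h ⊆ A ∧ A ⊆ univ ∧ #A = k :=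
    exists_subsuperset_card_eq (subset_univ _) hh.le (by rwa [card_univ, Fintype.card_fin])
  have hA : A ∈ powersetCard k (univ : Finset (Fin n)) := mem_powersetCard.2 ⟨subset_univ _, hAk⟩
  rw [← add_sum_erase _ _ hA]
  refine add_le_add (pow_le_one₀ hp0 hp1) ?_
  calc ∑ B ∈ (powersetCard k (univ : Finset (Fin n))).erase A, p ^ #(outEdges B h)
      ≤ ∑ B ∈ (powersetCard k (univ : Finset (Fin n))).erase A,
          p ^ (k.choose 2 - (#(A ∩ B)).choose 2) := by
        refine sum_le_sum fun B hB => pow_le_pow_of_le_one hp0 hp1 ?_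
        have hBk : #B = k := (mem_powersetCard.1 (mem_erase.1 hB).2).2
        rw [← hBk]
        exact choose_sub_le_card_outEdges A B h hhA
    _ ≤ k * 2 ^ k * (1 : ℝ) ^ k.choose 2 := sum_erase_pow_inter_le hk hn hp0 le_rfl hpb hA
    _ = k * 2 ^ k := by rw [one_pow, mul_one]

/-- The constant `e^{-2(1 + k 2^k)}`: an eventual lower bound for `Pr[ω_k(G(n,p_c) ∪ h) = 0]` over all
patterns `h` with fewer than `k` non-isolated vertices. [folklore] -/
def cfree (k : ℕ) : ℝ := Real.exp (-(2 * (1 + k * 2 ^ k)))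

/-- `cfree k > 0`. [folklore] -/
theorem cfree_pos (k : ℕ) : 0 < cfree k := Real.exp_pos _

/-- **Eventually, planting any pattern of support `< k` leaves `G(n,p_c)` clique-free with
probability `≥ cfree k = e^{-2(1+k2^k)}`.** [cite: Rossman2010, App. B (p. 14)] -/
theorem eventually_le_gnpProb_cliqueFree_sup {k : ℕ} (hk : 2 ≤ k) :
    ∀ᶠ n : ℕ in atTop, ∀ h : Edges n → Bool, #(supp h) < k →
      cfree k ≤ gnpProb n (pc n k) (univ.filter fun x : Edges n → Bool => cliqueFn n k (x ⊔ h) = false) := by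
  have hhalf : ∀ᶠ n : ℕ in atTop, pc n k ≤ 1 / 2 := (tendsto_pc hk).eventually_le_const (by norm_num)
  filter_upwards [hhalf, eventually_ge_atTop k] with n hpn hkn h hh
  have hp0 := pc_nonneg n k
  have hp1 : pc n k ≤ 1 := hpn.trans (by norm_num)
  have hpb : pc n k ≤ 1 * (n : ℝ) ^ (-(2 : ℝ) / ((k : ℝ) - 1)) := by rw [one_mul]; exact le_rfl
  refine le_trans ?_ (le_gnpProb_cliqueFree_sup hp0 hpn hk hh)
  rw [cfree, Real.exp_le_exp, neg_le_neg_iff]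
  exact mul_le_mul_of_nonneg_left (sum_pow_outEdges_le hk hkn hp0 hp1 hpb hh) (by norm_num)

/-! ### Every `f ≤ CLIQUE_k` is ⋆-closed at the critical self-noise parameters -/

/-- Members of `smallI ∪ medJ` have fewer than `k` non-isolated vertices. [folklore] -/
theorem card_supp_lt_of_mem_smallI_union_medJ {k : ℕ} {h : Edges n → Bool}
    (hh : h ∈ smallI n k ∪ medJ n k) : #(supp h) < k := by
  rcases mem_union.1 hh with h1 | h1
  · rw [mem_smallI] at h1; omega
  · rw [mem_medJ] at h1
    obtain ⟨-, x, hx, y, hy, rfl⟩ := h1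
    rw [mem_smallI] at hx hy
    rw [supp_sup]
    have := card_union_le (supp x) (supp y)
    omega

/-- **Sub-clique functions are ⋆-closed for free.** If `f ≤ CLIQUE_k` pointwise, the trigger `t` is
below `cfree k`, every pattern of `K` has support `< k`, and `n` is large
(`eventually_le_gnpProb_cliqueFree_sup`), then `f` is ⋆-closed for `(p_c, t, K)`: for every `h ∈ K`,
`Pr[f(G ∪ h) = 0] ≥ Pr[ω_k(G ∪ h) = 0] ≥ cfree k > t`, so the closure condition is never triggered.
No monotonicity needed. [folklore] -/
theorem isClosedFn_of_le_cliqueFn {k : ℕ} (hk : 2 ≤ k) (hn1 : 1 ≤ n)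
    (hn : ∀ h : Edges n → Bool, #(supp h) < k →
      cfree k ≤ gnpProb n (pc n k) (univ.filter fun x : Edges n → Bool => cliqueFn n k (x ⊔ h) = false))
    {t : ℝ} (ht : t < cfree k) {K : Finset (Edges n → Bool)} (hK : ∀ h ∈ K, #(supp h) < k)
    {f : (Edges n → Bool) → Bool} (hf : ∀ x, f x = true → cliqueFn n k x = true) :
    IsClosedFn (pc n k) t K f := by
  intro h hhK hfails
  exfalso
  have h1 : gnpProb n (pc n k) (univ.filter fun x : Edges n → Bool => cliqueFn n k (x ⊔ h) = false) ≤
      fails (pc n k) f h := by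
    rw [fails, gnpProb_filter_eq_prob]
    refine prob_mono (pc_nonneg n k) (pc_le_one hn1 hk) fun x hx => ?_
    by_contra hfx
    rw [Bool.not_eq_false] at hfx
    have := hf _ hfx
    rw [hx] at this
    exact Bool.false_ne_true this
  have := (hn h (hK h hhK)).trans (h1.trans hfails)
  linarith

/-! ### Generic `G(n,p)` / random-`k`-set bookkeeping -/

/-- `Pr[no edge of F is on] = (1-p)^{#F}`. [folklore] -/
theorem gnpProb_forall_off (p : ℝ) (F : Finset (Edges n)) :
    gnpProb n p (univ.filter fun x : Edges n → Bool => ∀ e ∈ F, x e = false) = (1 - p) ^ #F := by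
  have h := gnpProb_forall_not_allOn (n := n) F (fun e => ({e} : Finset (Edges n)))
    (fun i _ j _ hij => by simpa [Function.onFun] using hij) p
  simp only [mem_singleton, forall_eq, card_singleton, pow_one, prod_const] at h
  rw [← h]
  congr 1
  refine filter_congr fun x _ => ?_
  simp only [Bool.not_eq_true]

/-- The edges outside `K_A` number `C(n,2) - C(|A|,2)`. [folklore] -/
theorem card_filter_cliqueVec_false (A : Finset (Fin n)) :
    #(univ.filter fun e : Edges n => cliqueVec A e = false) = n.choose 2 - (#A).choose 2 := by
  have h := card_filter_add_card_filter_not (s := (univ : Finset (Edges n))) (fun e => cliqueVec A e = true)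
  rw [card_filter_cliqueVec, card_univ, card_edgeSet_top_fin] at h
  have h2 : (univ.filter fun e : Edges n => ¬ cliqueVec A e = true) =
      univ.filter fun e : Edges n => cliqueVec A e = false := by
    refine filter_congr fun e _ => ?_
    simp
  rw [h2] at h
  omega

/-- `Pr[G switches on no edge outside K_A] = (1-p)^{C(n,2) - C(|A|,2)}`. [folklore] -/
theorem gnpProb_off_outside (p : ℝ) (A : Finset (Fin n)) :
    gnpProb n p (univ.filter fun x : Edges n → Bool => ∀ e, cliqueVec A e = false → x e = false) =
      (1 - p) ^ (n.choose 2 - (#A).choose 2) := by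
  rw [← card_filter_cliqueVec_false A, ← gnpProb_forall_off p]
  congr 1
  refine filter_congr fun x _ => ?_
  simp only [mem_filter, mem_univ, true_and]

/-- `kSubsetProb` is monotone in the event, tested on `k`-sets only. [folklore] -/
theorem kSubsetProb_mono_card {k : ℕ} {P Q : Finset (Fin n) → Prop} [DecidablePred P] [DecidablePred Q]
    (h : ∀ A, #A = k → P A → Q A) : kSubsetProb n k P ≤ kSubsetProb n k Q := by
  unfold kSubsetProb
  refine div_le_div_of_nonneg_right ?_ (Nat.cast_nonneg _)
  exact_mod_cast card_le_card fun A hA => by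
    rw [mem_filter] at hA ⊢
    exact ⟨hA.1, h A (mem_powersetCard.1 hA.1).2 hA.2⟩

/-- Averaging an event over `G(n,p)` and the uniform `k`-set: swap the two sums. [folklore] -/
theorem sum_gnpWeight_mul_kSubsetProb {k : ℕ} (p : ℝ) (P : (Edges n → Bool) → Finset (Fin n) → Prop)
    [∀ x, DecidablePred (P x)] :
    ∑ x : Edges n → Bool, gnpWeight n p x * kSubsetProb n k (P x) =
      (∑ A ∈ powersetCard k (univ : Finset (Fin n)), gnpProb n p (univ.filter fun x => P x A)) /
        (n.choose k : ℝ) := by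
  have hx : ∀ x : Edges n → Bool, gnpWeight n p x * kSubsetProb n k (P x) =
      (∑ A ∈ powersetCard k (univ : Finset (Fin n)), if P x A then gnpWeight n p x else 0) /
        (n.choose k : ℝ) := by
    intro x
    rw [kSubsetProb, card_filter, mul_div_assoc', Nat.cast_sum, mul_sum]
    congr 1
    refine sum_congr rfl fun A _ => ?_
    split_ifs <;> simp
  rw [sum_congr rfl fun x _ => hx x, ← sum_div, sum_comm]
  congr 1
  refine sum_congr rfl fun A _ => ?_
  rw [gnpProb_filter]

end

end Summit.PneNP.PneNP.Theorems.SingleThreshold.Negative
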